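import Mathlib
import Literature.Combinatorics.Additive.TripleProductProperty

/-!
# A two-term packing inequality for STPP families (support for crux `AutomaticDesignBelowFourFifths`)

Route `MatrixMultiplication/AutomaticSTPPDesigns`, crux `stmt-MatrixMultiplication-7357`, line `Sketch`.
By the transfer file (`AutomaticDesignBelowFourFifths.crux_of_cyclicDesign` /
`cyclicDesign_of_crux`) the crux is equivalent to the existence of ONE finite STPP family
`(Aᵢ, Bᵢ, Cᵢ)ᵢ` in a cyclic group `ℤ/N` with `N < ∑ᵢ (|Aᵢ||Bᵢ||Cᵢ|)^{4/5}`. This file proves a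
necessary condition on such witnesses, valid in every finite abelian group `H`:

* `AddSimultaneousTPP.sum_erase_card_mul_card_add_sum_le` — **two-term packing inequality**: for an
  STPP family with all `Bᵢ, Cᵢ` nonempty and any index `j`,

    `∑_{i ≠ j} |Aᵢ||Bᵢ| + ∑ᵢ |Aᵢ||Cᵢ| ≤ |H|`.

  (The classical packing bounds of Blasiak–Church–Cohn–Grochow–Naslund–Sawin–Umans 2017, §2, are the
  one-term inequalities `∑ᵢ |Aᵢ||Bᵢ| ≤ |H|` etc.) Proof: the difference sets `Sᵢ = Aᵢ − Bᵢ` are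
  pairwise disjoint of sizes `|Aᵢ||Bᵢ|`, and so are the sets `Vₖ = Aₖ − Cₖ` (sizes `|Aₖ||Cₖ|`); by the
  cross clause of the STPP with index triple `(i, j, k)`, `i ≠ j`, the sumset
  `(⋃_{i ≠ j} Sᵢ) + (Bⱼ − Cⱼ)` is disjoint from `⋃ₖ Vₖ`; and it has at least `∑_{i ≠ j} |Sᵢ|` elements
  because `Bⱼ − Cⱼ ≠ ∅`.
* Consequences recorded for the crux (informal; see the evidence note of the line): summing the
  inequality and its two rotations gives `∑ᵢ (|Aᵢ||Bᵢ||Cᵢ|)^{2/3} ≤ |H| / (2 − 1/n)` for `n` triples —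
  no STPP family comes within a factor `2 − 1/n` of the Hölder packing bound — hence a witness of the
  crux needs a block with `|Aᵢ||Bᵢ||Cᵢ| > (2 − 1/n)^{15/2}` (`> 20` for `n = 2`, `> 181` as `n → ∞`).
-/

-- single-conjunct summit: the mandated namespace repeats `MatrixMultiplication`.
set_option linter.dupNamespace false

namespace Summit.MatrixMultiplication.MatrixMultiplication.Theorems

namespace AutomaticDesignBelowFourFifths

open Finset Literature.Combinatorics.Additive
open scoped Pointwise

section Clauses

variable {H : Type*} [AddCommGroup H] {ι : Type*} {A B C : ι → Finset H}

/-- In an STPP family (one-clause form), `a − b = a' − b'` with `(a, b) ∈ Aᵢ × Bᵢ`,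
`(a', b') ∈ Aᵢ' × Bᵢ'` forces `i = i'`, `a = a'`, `b = b'` (needs `Cᵢ' ≠ ∅`): the difference sets
`Aᵢ − Bᵢ` are pairwise disjoint and each difference is uniquely represented.
[cite: BlasiakChurchCohnGrochowNaslundSawinUmans2017, §2] -/
theorem sub_AB_inj (h : AddSimultaneousTPP A B C) (hC : ∀ i, (C i).Nonempty) {i i' : ι} {a b a' b' : H}
    (ha : a ∈ A i) (hb : b ∈ B i) (ha' : a' ∈ A i') (hb' : b' ∈ B i') (he : a - b = a' - b') :
    i = i' ∧ a = a' ∧ b = b' := by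
  rw [addSimultaneousTPP_iff_forall] at h
  obtain ⟨c, hc⟩ := hC i'
  have hrel : (a - a') + (b' - b) + (c - c) = 0 := by
    have : a - b - (a' - b') = 0 := sub_eq_zero.2 he
    rw [← this]; abel
  obtain ⟨h1, -, h2, h3, -⟩ := h i i' i' a' ha' a ha b hb b' hb' c hc c hc hrel
  exact ⟨h1, h2.symm, h3⟩

/-- In an STPP family (one-clause form), `a − c = a' − c'` with `(a, c) ∈ Aₖ × Cₖ`,
`(a', c') ∈ Aₖ' × Cₖ'` forces `k = k'`, `a = a'`, `c = c'` (needs `Bₖ ≠ ∅`).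
[cite: BlasiakChurchCohnGrochowNaslundSawinUmans2017, §2] -/
theorem sub_AC_inj (h : AddSimultaneousTPP A B C) (hB : ∀ i, (B i).Nonempty) {k k' : ι} {a c a' c' : H}
    (ha : a ∈ A k) (hc : c ∈ C k) (ha' : a' ∈ A k') (hc' : c' ∈ C k') (he : a - c = a' - c') :
    k = k' ∧ a = a' ∧ c = c' := by
  rw [addSimultaneousTPP_iff_forall] at h
  obtain ⟨b, hb⟩ := hB k
  -- relation `(s' - s) + (t' - t) + (u' - u) = 0` with `s := a' ∈ A k'`, `s' := a ∈ A k`,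
  -- `t = t' := b ∈ B k`, `u := c ∈ C k`, `u' := c' ∈ C k'`; indices `(k, k, k')`
  have hrel : (a - a') + (b - b) + (c' - c) = 0 := by
    have : a - c - (a' - c') = 0 := sub_eq_zero.2 he
    rw [← this]; abel
  obtain ⟨-, h1, h2, -, h3⟩ := h k k k' a' ha' a ha b hb b hb c hc c' hc' hrel
  exact ⟨h1, h2.symm, h3⟩

/-- The cross clause read on difference sets: for `i ≠ j`, no `x ∈ Aᵢ − Bᵢ`, `y ∈ Bⱼ − Cⱼ`,
`w ∈ Aₖ − Cₖ` satisfy `x + y = w`. [cite: CohnKleinbergSzegedyUmans2005, Def. 5.1] -/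
theorem sub_add_sub_ne_sub (h : AddSimultaneousTPP A B C) {i j k : ι} (hij : i ≠ j) {a b b' c a' c' : H}
    (ha : a ∈ A i) (hb : b ∈ B i) (hb' : b' ∈ B j) (hc : c ∈ C j) (ha' : a' ∈ A k) (hc' : c' ∈ C k) :
    (a - b) + (b' - c) ≠ a' - c' := by
  rw [addSimultaneousTPP_iff_forall] at h
  intro he
  have hrel : (a - a') + (b' - b) + (c' - c) = 0 := by
    have : (a - b) + (b' - c) - (a' - c') = 0 := sub_eq_zero.2 he
    rw [← this]; abel
  exact hij (h i j k a' ha' a ha b hb b' hb' c hc c' hc' hrel).1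

/-- The STPP is invariant under the cyclic rotation of roles `(A, B, C) ↦ (B, C, A)` (CKSU Def. 5.1
is visibly cyclic: the relation `aᵢ − a'ⱼ + bⱼ − b'ₖ + cₖ − c'ᵢ = 0` for `(A, B, C)` at `(i, j, k)` is
the relation for `(B, C, A)` at `(j, k, i)`). [cite: CohnKleinbergSzegedyUmans2005, Def. 5.1] -/
theorem rotate (h : AddSimultaneousTPP A B C) : AddSimultaneousTPP B C A := by
  refine ⟨fun i b hb b' hb' c hc c' hc' a ha a' ha' he => ?_,
    fun i j k b hb b' hb' c hc c' hc' a ha a' ha' he => ?_⟩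
  · have he' : a + -a' + (b + -b') + (c + -c') = 0 := by rw [← he]; abel
    obtain ⟨h1, h2, h3⟩ := h.1 i a ha a' ha' b hb b' hb' c hc c' hc' he'
    exact ⟨h2, h3, h1⟩
  · -- `a ∈ A k`, `a' ∈ A i`, `b ∈ B i`, `b' ∈ B j`, `c ∈ C j`, `c' ∈ C k`: clause (ii) at `(k, i, j)`
    have he' : a + -a' + b + -b' + c + -c' = 0 := by rw [← he]; abel
    obtain ⟨h1, h2⟩ := h.2 k i j a ha a' ha' b hb b' hb' c hc c' hc' he'
    exact ⟨h2, (h1.trans h2).symm⟩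

end Clauses

section Packing

variable {H : Type*} [AddCommGroup H] [Fintype H] [DecidableEq H] {ι : Type*} [Fintype ι]
  [DecidableEq ι] {A B C : ι → Finset H}

/-- **Two-term packing inequality.** For an STPP family `(Aᵢ, Bᵢ, Cᵢ)ᵢ` in a finite abelian group
`H` with all `Bᵢ`, `Cᵢ` nonempty and any index `j`:
`∑_{i ≠ j} |Aᵢ||Bᵢ| + ∑ᵢ |Aᵢ||Cᵢ| ≤ |H|`. (Strengthens the one-term packing bounds
`∑ᵢ |Aᵢ||Bᵢ| ≤ |H|`, `∑ᵢ |Cᵢ||Aᵢ| ≤ |H|` of Blasiak et al. 2017, §2: the sumset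
`(⋃_{i≠j} (Aᵢ − Bᵢ)) + (Bⱼ − Cⱼ)` has at least `∑_{i≠j} |Aᵢ||Bᵢ|` elements and misses the
`∑ᵢ |Aᵢ||Cᵢ|` elements of `⋃ₖ (Aₖ − Cₖ)`.) [cite: BlasiakChurchCohnGrochowNaslundSawinUmans2017, §2] -/
theorem sum_erase_card_mul_card_add_sum_le (h : AddSimultaneousTPP A B C)
    (hB : ∀ i, (B i).Nonempty) (hC : ∀ i, (C i).Nonempty) (j : ι) :
    ∑ i ∈ univ.erase j, (A i).card * (B i).card + ∑ i, (A i).card * (C i).card ≤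
      Fintype.card H := by
  classical
  -- the difference sets
  set dAB : ι → Finset H := fun i => (A i ×ˢ B i).image fun p => p.1 - p.2 with hdAB
  set dAC : ι → Finset H := fun i => (A i ×ˢ C i).image fun p => p.1 - p.2 with hdAC
  set T : Finset H := (B j ×ˢ C j).image fun p => p.1 - p.2 with hT
  have hcardAB : ∀ i, (dAB i).card = (A i).card * (B i).card := by
    intro i
    rw [hdAB, card_image_of_injOn, card_product]
    rintro ⟨a, b⟩ hab ⟨a', b'⟩ hab' he
    simp only [coe_product, Set.mem_prod, mem_coe] at hab hab'
    obtain ⟨-, rfl, rfl⟩ := sub_AB_inj h hC hab.1 hab.2 hab'.1 hab'.2 he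
    rfl
  have hcardAC : ∀ i, (dAC i).card = (A i).card * (C i).card := by
    intro i
    rw [hdAC, card_image_of_injOn, card_product]
    rintro ⟨a, c⟩ hac ⟨a', c'⟩ hac' he
    simp only [coe_product, Set.mem_prod, mem_coe] at hac hac'
    obtain ⟨-, rfl, rfl⟩ := sub_AC_inj h hB hac.1 hac.2 hac'.1 hac'.2 he
    rfl
  have hdisjAB : ∀ i ∈ (univ.erase j : Finset ι), ∀ i' ∈ (univ.erase j : Finset ι), i ≠ i' →
      Disjoint (dAB i) (dAB i') := by
    intro i _ i' _ hne
    rw [Finset.disjoint_left]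
    intro x hx hx'
    simp only [hdAB, mem_image, mem_product, Prod.exists] at hx hx'
    obtain ⟨a, b, ⟨ha, hb⟩, rfl⟩ := hx
    obtain ⟨a', b', ⟨ha', hb'⟩, he⟩ := hx'
    exact hne (sub_AB_inj h hC ha hb ha' hb' he.symm).1
  have hdisjAC : ∀ k ∈ (univ : Finset ι), ∀ k' ∈ (univ : Finset ι), k ≠ k' →
      Disjoint (dAC k) (dAC k') := by
    intro k _ k' _ hne
    rw [Finset.disjoint_left]
    intro x hx hx'
    simp only [hdAC, mem_image, mem_product, Prod.exists] at hx hx'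
    obtain ⟨a, c, ⟨ha, hc⟩, rfl⟩ := hx
    obtain ⟨a', c', ⟨ha', hc'⟩, he⟩ := hx'
    exact hne (sub_AC_inj h hB ha hc ha' hc' he.symm).1
  set X : Finset H := (univ.erase j).biUnion dAB with hX
  set V : Finset H := (univ : Finset ι).biUnion dAC with hV
  have hXcard : X.card = ∑ i ∈ univ.erase j, (A i).card * (B i).card := by
    rw [hX, card_biUnion hdisjAB]
    exact sum_congr rfl fun i _ => hcardAB i
  have hVcard : V.card = ∑ i, (A i).card * (C i).card := by
    rw [hV, card_biUnion hdisjAC]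
    exact sum_congr rfl fun i _ => hcardAC i
  -- `T ≠ ∅`, so `|X| ≤ |X + T|`
  have hTne : T.Nonempty := by
    obtain ⟨b, hb⟩ := hB j
    obtain ⟨c, hc⟩ := hC j
    exact ⟨b - c, mem_image.2 ⟨(b, c), mem_product.2 ⟨hb, hc⟩, rfl⟩⟩
  have hXle : X.card ≤ (X + T).card := card_le_card_add_right hTne
  -- `X + T` misses `V`
  have hdisj : Disjoint (X + T) V := by
    rw [Finset.disjoint_left]
    intro z hz hzV
    rw [mem_add] at hz
    obtain ⟨x, hx, y, hy, rfl⟩ := hz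
    simp only [hX, mem_biUnion, mem_erase, mem_univ, and_true, hdAB, mem_image, mem_product,
      Prod.exists] at hx
    obtain ⟨i, hij, a, b, ⟨ha, hb⟩, rfl⟩ := hx
    simp only [hT, mem_image, mem_product, Prod.exists] at hy
    obtain ⟨b', c, ⟨hb', hc⟩, rfl⟩ := hy
    simp only [hV, mem_biUnion, mem_univ, true_and, hdAC, mem_image, mem_product, Prod.exists] at hzV
    obtain ⟨k, a', c', ⟨ha', hc'⟩, he⟩ := hzV
    exact sub_add_sub_ne_sub h hij ha hb hb' hc ha' hc' he.symm
  calc ∑ i ∈ univ.erase j, (A i).card * (B i).card + ∑ i, (A i).card * (C i).card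
      = X.card + V.card := by rw [hXcard, hVcard]
    _ ≤ (X + T).card + V.card := by gcongr
    _ = ((X + T) ∪ V).card := (card_union_of_disjoint hdisj).symm
    _ ≤ Fintype.card H := card_le_univ _

/-- **Two-term packing inequality, summed form**: with all `Bᵢ, Cᵢ` nonempty,
`∑ᵢ |Aᵢ||Bᵢ| + ∑ᵢ |Aᵢ||Cᵢ| ≤ |H| + |Aⱼ||Bⱼ|` for every `j`.
[cite: BlasiakChurchCohnGrochowNaslundSawinUmans2017, §2] -/
theorem sum_card_mul_card_add_sum_le (h : AddSimultaneousTPP A B C)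
    (hB : ∀ i, (B i).Nonempty) (hC : ∀ i, (C i).Nonempty) (j : ι) :
    ∑ i, (A i).card * (B i).card + ∑ i, (A i).card * (C i).card ≤
      Fintype.card H + (A j).card * (B j).card := by
  have h1 := sum_erase_card_mul_card_add_sum_le h hB hC j
  have h2 : ∑ i, (A i).card * (B i).card =
      ∑ i ∈ univ.erase j, (A i).card * (B i).card + (A j).card * (B j).card :=
    (sum_erase_add _ _ (mem_univ j)).symm
  omega

omit [DecidableEq H] [DecidableEq ι] in
/-- **No STPP family comes within a factor `2 − 1/n` of the packing bound.** For an STPP family of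
`n ≥ 1` triples with all sets nonempty in a finite abelian group `H`,
`(2 − 1/n) · ∑ᵢ (|Aᵢ||Bᵢ||Cᵢ|)^{2/3} ≤ |H|` (the Hölder packing bound is `∑ᵢ (|Aᵢ||Bᵢ||Cᵢ|)^{2/3} ≤ |H|`).
Proof: the two-term inequality and its two rotations sum to
`2 (P_AB + P_BC + P_CA) ≤ 3|H| + (|Aⱼ||Bⱼ| + |Bⱼ||Cⱼ| + |Cⱼ||Aⱼ|)` for every `j`; take `j` minimising
the bracket (`≤ P/n`) and use `(|A||B||C|)^{2/3} ≤ (|A||B| + |B||C| + |C||A|)/3` (AM–GM).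
[cite: BlasiakChurchCohnGrochowNaslundSawinUmans2017, §2] -/
theorem sum_rpow_two_thirds_le [Nonempty ι] (h : AddSimultaneousTPP A B C) (hA : ∀ i, (A i).Nonempty)
    (hB : ∀ i, (B i).Nonempty) (hC : ∀ i, (C i).Nonempty) :
    (2 - 1 / (Fintype.card ι : ℝ)) *
        ∑ i, (((A i).card * (B i).card * (C i).card : ℕ) : ℝ) ^ ((2 : ℝ) / 3) ≤
      Fintype.card H := by
  classical
  -- notation: pair products and their sum `q i`
  set q : ι → ℕ := fun i => (A i).card * (B i).card + (B i).card * (C i).card +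
    (C i).card * (A i).card with hq
  -- the three two-term inequalities at a common index `j`, summed: `2 P ≤ 3 N + q j`
  have hsum : ∀ j, 2 * ∑ i, q i ≤ 3 * Fintype.card H + q j := by
    intro j
    have h1 := sum_card_mul_card_add_sum_le h hB hC j
    have h2 := sum_card_mul_card_add_sum_le (rotate h) hC hA j
    have h3 := sum_card_mul_card_add_sum_le (rotate (rotate h)) hA hB j
    have e1 : ∑ i, (A i).card * (C i).card = ∑ i, (C i).card * (A i).card :=
      sum_congr rfl fun i _ => Nat.mul_comm _ _
    have e2 : ∑ i, (B i).card * (A i).card = ∑ i, (A i).card * (B i).card :=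
      sum_congr rfl fun i _ => Nat.mul_comm _ _
    have e3 : ∑ i, (C i).card * (B i).card = ∑ i, (B i).card * (C i).card :=
      sum_congr rfl fun i _ => Nat.mul_comm _ _
    have eq : ∑ i, q i = ∑ i, (A i).card * (B i).card + ∑ i, (B i).card * (C i).card +
        ∑ i, (C i).card * (A i).card := by
      rw [hq, sum_add_distrib, sum_add_distrib]
    rw [e1] at h1; rw [e2] at h2; rw [e3] at h3
    rw [eq]
    simp only [hq]
    omega
  -- choose `j` minimising `q`
  obtain ⟨j, -, hj⟩ := exists_min_image (univ : Finset ι) q univ_nonempty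
  have hjn : Fintype.card ι * q j ≤ ∑ i, q i :=
    calc Fintype.card ι * q j = ∑ _i : ι, q j := by rw [sum_const, card_univ, smul_eq_mul]
      _ ≤ ∑ i, q i := sum_le_sum fun i _ => hj i (mem_univ i)
  -- AM–GM termwise: `vol^{2/3} ≤ q/3`
  have hamgm : ∀ i, (((A i).card * (B i).card * (C i).card : ℕ) : ℝ) ^ ((2 : ℝ) / 3) ≤
      (q i : ℝ) / 3 := by
    intro i
    set a : ℝ := ((A i).card : ℝ) with ha
    set b : ℝ := ((B i).card : ℝ) with hb
    set c : ℝ := ((C i).card : ℝ) with hc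
    have ha0 : 0 ≤ a := by positivity
    have hb0 : 0 ≤ b := by positivity
    have hc0 : 0 ≤ c := by positivity
    have key := Real.geom_mean_le_arith_mean3_weighted (w₁ := 1 / 3) (w₂ := 1 / 3) (w₃ := 1 / 3)
      (p₁ := a * b) (p₂ := b * c) (p₃ := c * a) (by norm_num) (by norm_num) (by norm_num)
      (by positivity) (by positivity) (by positivity) (by norm_num)
    have lhs : (a * b) ^ ((1 : ℝ) / 3) * (b * c) ^ ((1 : ℝ) / 3) * (c * a) ^ ((1 : ℝ) / 3) =
        (a * b * c) ^ ((2 : ℝ) / 3) := by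
      rw [← Real.mul_rpow (by positivity) (by positivity),
        ← Real.mul_rpow (by positivity) (by positivity)]
      have : a * b * (b * c) * (c * a) = (a * b * c) ^ ((2 : ℕ) : ℝ) := by
        rw [Real.rpow_natCast]; ring
      rw [this, ← Real.rpow_mul (by positivity)]
      norm_num
    have hcast : (((A i).card * (B i).card * (C i).card : ℕ) : ℝ) = a * b * c := by
      push_cast; rw [ha, hb, hc]
    have hqcast : (q i : ℝ) = a * b + b * c + c * a := by
      simp only [hq]; push_cast; rw [ha, hb, hc]
    rw [hcast, ← lhs, hqcast]
    linarith
  -- assemble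
  have hn : (0 : ℝ) < Fintype.card ι := by exact_mod_cast Fintype.card_pos
  have hP : (2 - 1 / (Fintype.card ι : ℝ)) * (∑ i, (q i : ℝ)) ≤ 3 * Fintype.card H := by
    have h2 := hsum j
    have h2' : (2 * ∑ i, q i : ℕ) ≤ 3 * Fintype.card H + q j := h2
    have h3 : ((Fintype.card ι * q j : ℕ) : ℝ) ≤ ∑ i, (q i : ℝ) := by exact_mod_cast hjn
    have h4 : ((2 * ∑ i, q i : ℕ) : ℝ) ≤ ((3 * Fintype.card H + q j : ℕ) : ℝ) := by
      exact_mod_cast h2'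
    push_cast at h3 h4
    rw [sub_mul, div_mul_eq_mul_div, one_mul]
    have h5 : (q j : ℝ) ≤ (∑ i, (q i : ℝ)) / Fintype.card ι := by
      rw [le_div_iff₀ hn]; linarith
    linarith
  have hS : ∑ i, (((A i).card * (B i).card * (C i).card : ℕ) : ℝ) ^ ((2 : ℝ) / 3) ≤
      (∑ i, (q i : ℝ)) / 3 := by
    rw [sum_div]
    exact sum_le_sum fun i _ => hamgm i
  have hcoef : 0 ≤ 2 - 1 / (Fintype.card ι : ℝ) := by
    have : 1 / (Fintype.card ι : ℝ) ≤ 1 := by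
      rw [div_le_one hn]; exact_mod_cast Fintype.card_pos
    linarith
  calc (2 - 1 / (Fintype.card ι : ℝ)) *
        ∑ i, (((A i).card * (B i).card * (C i).card : ℕ) : ℝ) ^ ((2 : ℝ) / 3)
      ≤ (2 - 1 / (Fintype.card ι : ℝ)) * ((∑ i, (q i : ℝ)) / 3) :=
        mul_le_mul_of_nonneg_left hS hcoef
    _ = (2 - 1 / (Fintype.card ι : ℝ)) * (∑ i, (q i : ℝ)) / 3 := by ring
    _ ≤ 3 * Fintype.card H / 3 := by gcongr
    _ = Fintype.card H := by ring

end Packing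

/-! ### Registered sub-goals (stubs) of crux `stmt-MatrixMultiplication-7357`, closed forms -/

/-- **Registered stub `stub_twoTermPacking`** (closed form of `sum_erase_card_mul_card_add_sum_le`):
the two-term packing inequality. [cite: BlasiakChurchCohnGrochowNaslundSawinUmans2017, §2] -/
theorem stub_twoTermPacking : ∀ (H : Type) [AddCommGroup H] [Fintype H] [DecidableEq H] (ι : Type) [Fintype ι] [DecidableEq ι] (A B C : ι → Finset H), Literature.Combinatorics.Additive.AddSimultaneousTPP A B C → (∀ i, (B i).Nonempty) → (∀ i, (C i).Nonempty) → ∀ j : ι, ∑ i ∈ Finset.univ.erase j, (A i).card * (B i).card + ∑ i, (A i).card * (C i).card ≤ Fintype.card H :=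
  fun _ _ _ _ _ _ _ _ _ _ h hB hC j => sum_erase_card_mul_card_add_sum_le h hB hC j

/-- **Registered stub `stub_packingTwoThirds`** (closed form of `sum_rpow_two_thirds_le`): no STPP
family comes within a factor `2 − 1/n` of the packing bound.
[cite: BlasiakChurchCohnGrochowNaslundSawinUmans2017, §2] -/
theorem stub_packingTwoThirds : ∀ (H : Type) [AddCommGroup H] [Fintype H] (ι : Type) [Fintype ι] [Nonempty ι] (A B C : ι → Finset H), Literature.Combinatorics.Additive.AddSimultaneousTPP A B C → (∀ i, (A i).Nonempty) → (∀ i, (B i).Nonempty) → (∀ i, (C i).Nonempty) → (2 - 1 / (Fintype.card ι : ℝ)) * ∑ i, (((A i).card * (B i).card * (C i).card : ℕ) : ℝ) ^ ((2 : ℝ) / 3) ≤ Fintype.card H := by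
  intro H _ _ ι _ _ A B C h hA hB hC
  classical
  exact sum_rpow_two_thirds_le h hA hB hC

end AutomaticDesignBelowFourFifths

end Summit.MatrixMultiplication.MatrixMultiplication.Theorems
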